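import Summits.MatrixMultiplication.OmegaCensus.STPPVosperTableLaw
import Summits.MatrixMultiplication.OmegaCensus.STPP222SqSymmetry
import Summits.MatrixMultiplication.OmegaCensus.STPPDisjointPacking

/-!
# ω-census (abelian STPP census): seven Vosper-table kills at `ℤ₆₁` (kernel)

HONEST FRAMING (pub-omega census; verbatim): lottery ticket; floor = certified bounds/negative ranges.
Census STRUCTURE (seat pub-omega-stpp-1 gen 29, 2026-08-28), family (b2).  Applications of the Vosper table law `no_isSTPP_of_tight_table`
(`STPPVosperTableLaw.lean`): each theorem EXCLUDES one minimal beating pattern of `ℤ₆₁` (`Σ aᵢbᵢcᵢ ≥ 62`) that is alive under the python filters of record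
N7–N20 (approximate enumeration `≤ 3` blocks, entries `≤ 8`, HOME `pub-omega-stpp-1-g29/scan/vosper_scan_61_nb3.json`) and N18-tight in the stated role
reading; the only pattern-specific input is the window table, decided on `ℕ` by `decide +kernel`.  Nothing here is progress on `ω`; several of these
patterns are already ENGINE-dead through the universal 2-block cores of HOME `pub-omega-stpp-1-g28/fronts/universal-cores-5863.json` — the theorems make
them KERNEL-dead.

| pattern | reading | tight block | `(z, b, vol, a, L)` | table `(n, m, r)` |
|---|---|---|---|---|
| `{(1,1,2),(2,5,3),(3,5,2)}` | `(a,b,c)` | `(3,5,2)` | `(8,5,30,3,17)` | `(49,19,5)` |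
| `{(1,1,3),(2,4,4),(3,3,3)}` | `(a,b,c)` | `(3,3,3)` | `(11,3,27,3,19)` | `(48,21,3)` |
| `{(1,2,2),(2,4,4),(3,3,3)}` | `(a,b,c)` | `(3,3,3)` | `(10,3,27,3,20)` | `(49,22,3)` |
| `{(2,3,3),(3,2,3),(3,3,3)}` | `(a,b,c)` | `(3,3,3)` | `(15,3,27,3,15)` | `(44,17,3)` |
| `{(1,2,4),(3,3,3),(3,3,3)}` | `(b,a,c)` = `(−B,−A,−C)` | `(3,3,3)` | `(17,3,27,3,13)` | `(42,15,3)` |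
| `{(2,2,3),(3,3,3),(3,4,2)}` | `(a,c,b)` = `(−A,−C,−B)` | `(3,3,3)` | `(16,3,27,3,14)` | `(43,16,3)` |
| `{(2,3,6),(3,3,3)}` | `(b,c,a)` = `(B,C,A)` | `(3,6,2)` | `(9,6,36,3,9)` | `(47,11,6)` |

Role readings via `STPPDisjointPacking.stpp_rotate` and `STPP222SqNeg.isSTPP_negSwap`.  Independent python reading of the seven tables: HOME
`pub-omega-stpp-1-g29/code/p6_tables.py` (survivors `{0, 1, 60}` each).

References: A. G. Vosper, J. London Math. Soc. 31 (1956); M. B. Nathanson, *Additive Number Theory: Inverse Problems*, GTM 165, Thm 2.7; H. Cohn,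
R. Kleinberg, B. Szegedy, C. Umans, FOCS 2005 (arXiv:math/0511460), Def. 5.1.
-/

open Finset
open scoped Pointwise

namespace Summit.MatrixMultiplication.OmegaCensus.CubeNB

open Literature.Computability.AlgebraicComplexity
open Literature.Combinatorics.Additive
open Summit.MatrixMultiplication.OmegaCensus.STPPKneser

/-! ## The seven window tables (`ℕ`, `decide +kernel`) -/

section Tables

/-- Table `(n, m, r) = (49, 19, 5)`: for all `j, t < 61`, the 19 positions `(t + j·i) mod 61` in `[0,49)` with the prefix law `5 ∣ pos − #(earlier below)`
at each force `j ∈ {0, 1, 60}`. [folklore] -/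
theorem table_49_19_5 : ∀ j < 61, ∀ t < 61, (∀ i < 19, (t + j * i) % 61 < 49) →
    (∀ k < 19, 5 ∣ (t + j * k) % 61 - #((range 19).filter fun i => (t + j * i) % 61 < (t + j * k) % 61)) →
    j ∈ ({0, 1, 60} : Finset ℕ) := by
  decide +kernel

/-- Table `(n, m, r) = (48, 21, 3)`: for all `j, t < 61`, the 21 positions `(t + j·i) mod 61` in `[0,48)` with the prefix law `3 ∣ pos − #(earlier below)`
at each force `j ∈ {0, 1, 60}`. [folklore] -/
theorem table_48_21_3 : ∀ j < 61, ∀ t < 61, (∀ i < 21, (t + j * i) % 61 < 48) →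
    (∀ k < 21, 3 ∣ (t + j * k) % 61 - #((range 21).filter fun i => (t + j * i) % 61 < (t + j * k) % 61)) →
    j ∈ ({0, 1, 60} : Finset ℕ) := by
  decide +kernel

/-- Table `(n, m, r) = (49, 22, 3)`: for all `j, t < 61`, the 22 positions `(t + j·i) mod 61` in `[0,49)` with the prefix law `3 ∣ pos − #(earlier below)`
at each force `j ∈ {0, 1, 60}`. [folklore] -/
theorem table_49_22_3 : ∀ j < 61, ∀ t < 61, (∀ i < 22, (t + j * i) % 61 < 49) →
    (∀ k < 22, 3 ∣ (t + j * k) % 61 - #((range 22).filter fun i => (t + j * i) % 61 < (t + j * k) % 61)) →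
    j ∈ ({0, 1, 60} : Finset ℕ) := by
  decide +kernel

/-- Table `(n, m, r) = (44, 17, 3)`: for all `j, t < 61`, the 17 positions `(t + j·i) mod 61` in `[0,44)` with the prefix law `3 ∣ pos − #(earlier below)`
at each force `j ∈ {0, 1, 60}`. [folklore] -/
theorem table_44_17_3 : ∀ j < 61, ∀ t < 61, (∀ i < 17, (t + j * i) % 61 < 44) →
    (∀ k < 17, 3 ∣ (t + j * k) % 61 - #((range 17).filter fun i => (t + j * i) % 61 < (t + j * k) % 61)) →
    j ∈ ({0, 1, 60} : Finset ℕ) := by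
  decide +kernel

/-- Table `(n, m, r) = (42, 15, 3)`: for all `j, t < 61`, the 15 positions `(t + j·i) mod 61` in `[0,42)` with the prefix law `3 ∣ pos − #(earlier below)`
at each force `j ∈ {0, 1, 60}`. [folklore] -/
theorem table_42_15_3 : ∀ j < 61, ∀ t < 61, (∀ i < 15, (t + j * i) % 61 < 42) →
    (∀ k < 15, 3 ∣ (t + j * k) % 61 - #((range 15).filter fun i => (t + j * i) % 61 < (t + j * k) % 61)) →
    j ∈ ({0, 1, 60} : Finset ℕ) := by
  decide +kernel

/-- Table `(n, m, r) = (43, 16, 3)`: for all `j, t < 61`, the 16 positions `(t + j·i) mod 61` in `[0,43)` with the prefix law `3 ∣ pos − #(earlier below)`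
at each force `j ∈ {0, 1, 60}`. [folklore] -/
theorem table_43_16_3 : ∀ j < 61, ∀ t < 61, (∀ i < 16, (t + j * i) % 61 < 43) →
    (∀ k < 16, 3 ∣ (t + j * k) % 61 - #((range 16).filter fun i => (t + j * i) % 61 < (t + j * k) % 61)) →
    j ∈ ({0, 1, 60} : Finset ℕ) := by
  decide +kernel

/-- Table `(n, m, r) = (47, 11, 6)`: for all `j, t < 61`, the 11 positions `(t + j·i) mod 61` in `[0,47)` with the prefix law `6 ∣ pos − #(earlier below)`
at each force `j ∈ {0, 1, 60}`. [folklore] -/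
theorem table_47_11_6 : ∀ j < 61, ∀ t < 61, (∀ i < 11, (t + j * i) % 61 < 47) →
    (∀ k < 11, 6 ∣ (t + j * k) % 61 - #((range 11).filter fun i => (t + j * i) % 61 < (t + j * k) % 61)) →
    j ∈ ({0, 1, 60} : Finset ℕ) := by
  decide +kernel

end Tables

/-! ## The seven kills -/

section Kills

/-- **`{(1,1,2),(2,5,3),(3,5,2)}` has no STPP family in `ℤ₆₁`** (Vosper table law, reading `(a,b,c)`, tight block `(3,5,2)`, table `(49,19,5)`).
[cite: CohnKleinbergSzegedyUmans2005, Def. 5.1] [cite: Nathanson1996, Thm 2.7] -/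
theorem no_isSTPP_zmod61_112_253_352 (A B C : Fin 3 → Finset (ZMod 61)) (hS : IsSTPP A B C)
    (hA : ∀ i, #(A i) = ![1, 2, 3] i) (hB : ∀ i, #(B i) = ![1, 5, 5] i) (hC : ∀ i, #(C i) = ![2, 3, 2] i) :
    False := by
  have hAne : ∀ i, (A i).Nonempty := fun i => card_pos.1 (by rw [hA]; fin_cases i <;> simp)
  have hBne : ∀ i, (B i).Nonempty := fun i => card_pos.1 (by rw [hB]; fin_cases i <;> simp)
  have hCne : ∀ i, (C i).Nonempty := fun i => card_pos.1 (by rw [hC]; fin_cases i <;> simp)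
  have e2 : (univ : Finset (Fin 3)).erase 2 = {0, 1} := by decide
  have hz : ∑ k ∈ (univ : Finset (Fin 3)).erase 2, #(A k) * #(C k) = 8 := by
    rw [e2, Finset.sum_pair (by decide)]; simp [hA, hC]
  have hL : ∑ k ∈ (univ : Finset (Fin 3)).erase 2, #(B k) * #(C k) = 17 := by
    rw [e2, Finset.sum_pair (by decide)]; simp [hB, hC]
  have ha : #(A 2) = 3 := by rw [hA]; simp
  have hb : #(B 2) = 5 := by rw [hB]; simp
  have hvol : #(A 2) * #(B 2) * #(C 2) = 30 := by rw [hA, hB, hC]; simp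
  exact no_isSTPP_of_tight_table A B C hS hAne hBne hCne 2 ⟨0, by decide⟩ ha hb hvol hz hL (by norm_num) (by norm_num)
    (by norm_num) (by norm_num) (by norm_num) (m := 19) (n := 49) rfl rfl table_49_19_5

/-- **`{(1,1,3),(2,4,4),(3,3,3)}` has no STPP family in `ℤ₆₁`** (Vosper table law, reading `(a,b,c)`, tight block `(3,3,3)`, table `(48,21,3)`).
[cite: CohnKleinbergSzegedyUmans2005, Def. 5.1] [cite: Nathanson1996, Thm 2.7] -/
theorem no_isSTPP_zmod61_113_244_333 (A B C : Fin 3 → Finset (ZMod 61)) (hS : IsSTPP A B C)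
    (hA : ∀ i, #(A i) = ![1, 2, 3] i) (hB : ∀ i, #(B i) = ![1, 4, 3] i) (hC : ∀ i, #(C i) = ![3, 4, 3] i) :
    False := by
  have hAne : ∀ i, (A i).Nonempty := fun i => card_pos.1 (by rw [hA]; fin_cases i <;> simp)
  have hBne : ∀ i, (B i).Nonempty := fun i => card_pos.1 (by rw [hB]; fin_cases i <;> simp)
  have hCne : ∀ i, (C i).Nonempty := fun i => card_pos.1 (by rw [hC]; fin_cases i <;> simp)
  have e2 : (univ : Finset (Fin 3)).erase 2 = {0, 1} := by decide
  have hz : ∑ k ∈ (univ : Finset (Fin 3)).erase 2, #(A k) * #(C k) = 11 := by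
    rw [e2, Finset.sum_pair (by decide)]; simp [hA, hC]
  have hL : ∑ k ∈ (univ : Finset (Fin 3)).erase 2, #(B k) * #(C k) = 19 := by
    rw [e2, Finset.sum_pair (by decide)]; simp [hB, hC]
  have ha : #(A 2) = 3 := by rw [hA]; simp
  have hb : #(B 2) = 3 := by rw [hB]; simp
  have hvol : #(A 2) * #(B 2) * #(C 2) = 27 := by rw [hA, hB, hC]; simp
  exact no_isSTPP_of_tight_table A B C hS hAne hBne hCne 2 ⟨0, by decide⟩ ha hb hvol hz hL (by norm_num) (by norm_num)
    (by norm_num) (by norm_num) (by norm_num) (m := 21) (n := 48) rfl rfl table_48_21_3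

/-- **`{(1,2,2),(2,4,4),(3,3,3)}` has no STPP family in `ℤ₆₁`** (Vosper table law, reading `(a,b,c)`, tight block `(3,3,3)`, table `(49,22,3)`).
[cite: CohnKleinbergSzegedyUmans2005, Def. 5.1] [cite: Nathanson1996, Thm 2.7] -/
theorem no_isSTPP_zmod61_122_244_333 (A B C : Fin 3 → Finset (ZMod 61)) (hS : IsSTPP A B C)
    (hA : ∀ i, #(A i) = ![1, 2, 3] i) (hB : ∀ i, #(B i) = ![2, 4, 3] i) (hC : ∀ i, #(C i) = ![2, 4, 3] i) :
    False := by
  have hAne : ∀ i, (A i).Nonempty := fun i => card_pos.1 (by rw [hA]; fin_cases i <;> simp)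
  have hBne : ∀ i, (B i).Nonempty := fun i => card_pos.1 (by rw [hB]; fin_cases i <;> simp)
  have hCne : ∀ i, (C i).Nonempty := fun i => card_pos.1 (by rw [hC]; fin_cases i <;> simp)
  have e2 : (univ : Finset (Fin 3)).erase 2 = {0, 1} := by decide
  have hz : ∑ k ∈ (univ : Finset (Fin 3)).erase 2, #(A k) * #(C k) = 10 := by
    rw [e2, Finset.sum_pair (by decide)]; simp [hA, hC]
  have hL : ∑ k ∈ (univ : Finset (Fin 3)).erase 2, #(B k) * #(C k) = 20 := by
    rw [e2, Finset.sum_pair (by decide)]; simp [hB, hC]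
  have ha : #(A 2) = 3 := by rw [hA]; simp
  have hb : #(B 2) = 3 := by rw [hB]; simp
  have hvol : #(A 2) * #(B 2) * #(C 2) = 27 := by rw [hA, hB, hC]; simp
  exact no_isSTPP_of_tight_table A B C hS hAne hBne hCne 2 ⟨0, by decide⟩ ha hb hvol hz hL (by norm_num) (by norm_num)
    (by norm_num) (by norm_num) (by norm_num) (m := 22) (n := 49) rfl rfl table_49_22_3

/-- **`{(2,3,3),(3,2,3),(3,3,3)}` has no STPP family in `ℤ₆₁`** (Vosper table law, reading `(a,b,c)`, tight block `(3,3,3)`, table `(44,17,3)`).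
[cite: CohnKleinbergSzegedyUmans2005, Def. 5.1] [cite: Nathanson1996, Thm 2.7] -/
theorem no_isSTPP_zmod61_233_323_333 (A B C : Fin 3 → Finset (ZMod 61)) (hS : IsSTPP A B C)
    (hA : ∀ i, #(A i) = ![2, 3, 3] i) (hB : ∀ i, #(B i) = ![3, 2, 3] i) (hC : ∀ i, #(C i) = ![3, 3, 3] i) :
    False := by
  have hAne : ∀ i, (A i).Nonempty := fun i => card_pos.1 (by rw [hA]; fin_cases i <;> simp)
  have hBne : ∀ i, (B i).Nonempty := fun i => card_pos.1 (by rw [hB]; fin_cases i <;> simp)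
  have hCne : ∀ i, (C i).Nonempty := fun i => card_pos.1 (by rw [hC]; fin_cases i <;> simp)
  have e2 : (univ : Finset (Fin 3)).erase 2 = {0, 1} := by decide
  have hz : ∑ k ∈ (univ : Finset (Fin 3)).erase 2, #(A k) * #(C k) = 15 := by
    rw [e2, Finset.sum_pair (by decide)]; simp [hA, hC]
  have hL : ∑ k ∈ (univ : Finset (Fin 3)).erase 2, #(B k) * #(C k) = 15 := by
    rw [e2, Finset.sum_pair (by decide)]; simp [hB, hC]
  have ha : #(A 2) = 3 := by rw [hA]; simp
  have hb : #(B 2) = 3 := by rw [hB]; simp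
  have hvol : #(A 2) * #(B 2) * #(C 2) = 27 := by rw [hA, hB, hC]; simp
  exact no_isSTPP_of_tight_table A B C hS hAne hBne hCne 2 ⟨0, by decide⟩ ha hb hvol hz hL (by norm_num) (by norm_num)
    (by norm_num) (by norm_num) (by norm_num) (m := 17) (n := 44) rfl rfl table_44_17_3

/-- **`{(1,2,4),(3,3,3),(3,3,3)}` has no STPP family in `ℤ₆₁`** (Vosper table law in the reading `(b,a,c)`, i.e. for the STPP family `(−B, −A, −C)`
(`stpp_rotate` then `isSTPP_negSwap`); tight block `(3,3,3)`, table `(42,15,3)`). [cite: CohnKleinbergSzegedyUmans2005, Def. 5.1] [cite: Nathanson1996, Thm 2.7] -/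
theorem no_isSTPP_zmod61_124_333_333 (A B C : Fin 3 → Finset (ZMod 61)) (hS : IsSTPP A B C)
    (hA : ∀ i, #(A i) = ![1, 3, 3] i) (hB : ∀ i, #(B i) = ![2, 3, 3] i) (hC : ∀ i, #(C i) = ![4, 3, 3] i) :
    False := by
  have hAne : ∀ i, (A i).Nonempty := fun i => card_pos.1 (by rw [hA]; fin_cases i <;> simp)
  have hBne : ∀ i, (B i).Nonempty := fun i => card_pos.1 (by rw [hB]; fin_cases i <;> simp)
  have hCne : ∀ i, (C i).Nonempty := fun i => card_pos.1 (by rw [hC]; fin_cases i <;> simp)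
  -- the family (−B, −A, −C)
  set A' : Fin 3 → Finset (ZMod 61) := fun t => (B t).image Neg.neg with hA'
  set B' : Fin 3 → Finset (ZMod 61) := fun t => (A t).image Neg.neg with hB'
  set C' : Fin 3 → Finset (ZMod 61) := fun t => (C t).image Neg.neg with hC'
  have hS' : IsSTPP A' B' C' := STPP222SqNeg.isSTPP_negSwap (stpp_rotate hS)
  have hcA' : ∀ t, #(A' t) = #(B t) := fun t => Finset.card_image_of_injective _ neg_injective
  have hcB' : ∀ t, #(B' t) = #(A t) := fun t => Finset.card_image_of_injective _ neg_injective
  have hcC' : ∀ t, #(C' t) = #(C t) := fun t => Finset.card_image_of_injective _ neg_injective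
  have hAne' : ∀ t, (A' t).Nonempty := fun t => (hBne t).image _
  have hBne' : ∀ t, (B' t).Nonempty := fun t => (hAne t).image _
  have hCne' : ∀ t, (C' t).Nonempty := fun t => (hCne t).image _
  have e1 : (univ : Finset (Fin 3)).erase 1 = {0, 2} := by decide
  have hz : ∑ k ∈ (univ : Finset (Fin 3)).erase 1, #(A' k) * #(C' k) = 17 := by
    rw [e1, Finset.sum_pair (by decide)]; simp [hcA', hcC', hB, hC]
  have hL : ∑ k ∈ (univ : Finset (Fin 3)).erase 1, #(B' k) * #(C' k) = 13 := by
    rw [e1, Finset.sum_pair (by decide)]; simp [hcB', hcC', hA, hC]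
  have ha : #(A' 1) = 3 := by rw [hcA', hB]; simp
  have hb : #(B' 1) = 3 := by rw [hcB', hA]; simp
  have hvol : #(A' 1) * #(B' 1) * #(C' 1) = 27 := by rw [hcA', hcB', hcC', hA, hB, hC]; simp
  exact no_isSTPP_of_tight_table A' B' C' hS' hAne' hBne' hCne' 1 ⟨0, by decide⟩ ha hb hvol hz hL (by norm_num) (by norm_num)
    (by norm_num) (by norm_num) (by norm_num) (m := 15) (n := 42) rfl rfl table_42_15_3

/-- **`{(2,2,3),(3,3,3),(3,4,2)}` has no STPP family in `ℤ₆₁`** (Vosper table law in the reading `(a,c,b)`, i.e. for the STPP family `(−A, −C, −B)`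
(`isSTPP_negSwap`); tight block `(3,3,3)`, table `(43,16,3)`). [cite: CohnKleinbergSzegedyUmans2005, Def. 5.1] [cite: Nathanson1996, Thm 2.7] -/
theorem no_isSTPP_zmod61_223_333_342 (A B C : Fin 3 → Finset (ZMod 61)) (hS : IsSTPP A B C)
    (hA : ∀ i, #(A i) = ![2, 3, 3] i) (hB : ∀ i, #(B i) = ![2, 3, 4] i) (hC : ∀ i, #(C i) = ![3, 3, 2] i) :
    False := by
  have hAne : ∀ i, (A i).Nonempty := fun i => card_pos.1 (by rw [hA]; fin_cases i <;> simp)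
  have hBne : ∀ i, (B i).Nonempty := fun i => card_pos.1 (by rw [hB]; fin_cases i <;> simp)
  have hCne : ∀ i, (C i).Nonempty := fun i => card_pos.1 (by rw [hC]; fin_cases i <;> simp)
  set A' : Fin 3 → Finset (ZMod 61) := fun t => (A t).image Neg.neg with hA'
  set B' : Fin 3 → Finset (ZMod 61) := fun t => (C t).image Neg.neg with hB'
  set C' : Fin 3 → Finset (ZMod 61) := fun t => (B t).image Neg.neg with hC'
  have hS' : IsSTPP A' B' C' := STPP222SqNeg.isSTPP_negSwap hS
  have hcA' : ∀ t, #(A' t) = #(A t) := fun t => Finset.card_image_of_injective _ neg_injective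
  have hcB' : ∀ t, #(B' t) = #(C t) := fun t => Finset.card_image_of_injective _ neg_injective
  have hcC' : ∀ t, #(C' t) = #(B t) := fun t => Finset.card_image_of_injective _ neg_injective
  have hAne' : ∀ t, (A' t).Nonempty := fun t => (hAne t).image _
  have hBne' : ∀ t, (B' t).Nonempty := fun t => (hCne t).image _
  have hCne' : ∀ t, (C' t).Nonempty := fun t => (hBne t).image _
  have e1 : (univ : Finset (Fin 3)).erase 1 = {0, 2} := by decide
  have hz : ∑ k ∈ (univ : Finset (Fin 3)).erase 1, #(A' k) * #(C' k) = 16 := by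
    rw [e1, Finset.sum_pair (by decide)]; simp [hcA', hcC', hA, hB]
  have hL : ∑ k ∈ (univ : Finset (Fin 3)).erase 1, #(B' k) * #(C' k) = 14 := by
    rw [e1, Finset.sum_pair (by decide)]; simp [hcB', hcC', hB, hC]
  have ha : #(A' 1) = 3 := by rw [hcA', hA]; simp
  have hb : #(B' 1) = 3 := by rw [hcB', hC]; simp
  have hvol : #(A' 1) * #(B' 1) * #(C' 1) = 27 := by rw [hcA', hcB', hcC', hA, hB, hC]; simp
  exact no_isSTPP_of_tight_table A' B' C' hS' hAne' hBne' hCne' 1 ⟨0, by decide⟩ ha hb hvol hz hL (by norm_num) (by norm_num)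
    (by norm_num) (by norm_num) (by norm_num) (m := 16) (n := 43) rfl rfl table_43_16_3

/-- **`{(2,3,6),(3,3,3)}` has no STPP family in `ℤ₆₁`** (Vosper table law in the reading `(b,c,a)`, i.e. for the rotated family `(B, C, A)` (`stpp_rotate`);
tight block `(3,6,2)`, table `(47,11,6)`).  (At order `59` this pattern is N18-dead: `STPPAlignedDoubleKneserFilter.no_isSTPP_Z59_236_333`.)
[cite: CohnKleinbergSzegedyUmans2005, Def. 5.1] [cite: Nathanson1996, Thm 2.7] -/
theorem no_isSTPP_zmod61_236_333 (A B C : Fin 2 → Finset (ZMod 61)) (hS : IsSTPP A B C)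
    (hA : ∀ i, #(A i) = ![2, 3] i) (hB : ∀ i, #(B i) = ![3, 3] i) (hC : ∀ i, #(C i) = ![6, 3] i) : False := by
  have hAne : ∀ i, (A i).Nonempty := fun i => card_pos.1 (by rw [hA]; fin_cases i <;> simp)
  have hBne : ∀ i, (B i).Nonempty := fun i => card_pos.1 (by rw [hB]; fin_cases i <;> simp)
  have hCne : ∀ i, (C i).Nonempty := fun i => card_pos.1 (by rw [hC]; fin_cases i <;> simp)
  have hS' : IsSTPP B C A := stpp_rotate hS
  have e0 : (univ : Finset (Fin 2)).erase 0 = {1} := by decide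
  have hz : ∑ k ∈ (univ : Finset (Fin 2)).erase 0, #(B k) * #(A k) = 9 := by rw [e0, Finset.sum_singleton, hB, hA]; simp
  have hL : ∑ k ∈ (univ : Finset (Fin 2)).erase 0, #(C k) * #(A k) = 9 := by rw [e0, Finset.sum_singleton, hC, hA]; simp
  have ha : #(B 0) = 3 := by rw [hB]; simp
  have hb : #(C 0) = 6 := by rw [hC]; simp
  have hvol : #(B 0) * #(C 0) * #(A 0) = 36 := by rw [hA, hB, hC]; simp
  exact no_isSTPP_of_tight_table B C A hS' hBne hCne hAne 0 ⟨1, by decide⟩ ha hb hvol hz hL (by norm_num) (by norm_num)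
    (by norm_num) (by norm_num) (by norm_num) (m := 11) (n := 47) rfl rfl table_47_11_6

end Kills

end Summit.MatrixMultiplication.OmegaCensus.CubeNB
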